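import Summits.QuantumFields.YangMills.Theorems.BalabanLadderUVOtherGroupsDefs
import Summits.QuantumFields.YangMills.Theorems.BalabanLadderUVRecord12
import Summits.QuantumFields.YangMills.Theorems.BalabanUVNodesClustersLeaf
import HarnessLib

/-!
# Route `BalabanLadder`, crux `UVOtherGroups` (stmt-QuantumFields-19356): the pinned-record UV packages ⇒ `UVD59 N` ∕ `UV` ∕ `UVApexSUN` ∕ `UVSUN` BY NAME

Helper file (`--supports stmt-QuantumFields-19356`, fleet seat `ym-osasm-p2`, director-ym R136 (iii)); pure theorems, one line each.  ★ym-osasm-p1 g3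
named Track A's rev-15 output ONE LINE BEFORE the Stage-0 projection as two route-independent packages (`Theorems/BalabanLadderUVRecord12Defs.lean`,
p468625): `Cruxes.UV.Record12.UVAtParams12 N` (θ-keyed) and `UVAtRecord12C N` ((D, w)-keyed), with kernels `stage0_of_uvAtParams12` ∕
`stage0_of_uvAtRecord12C` whose conclusions are VERBATIM the body of `YMDAG.UVSplit.UVD59 N` (p469336).  Those modules import no `Theses` file by
design, so they cannot name the leaf; THIS file (which lives in the spine's cone anyway, through `UVSUN`) states the junctions BY NAME, for every `N`:

* `uvD59_of_uvAtParams12`, `uvD59_of_uvAtRecord12C` — package ⇒ `YMDAG.UVSplit.UVD59 N`;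
* `uv_of_uvAtParams12_two`, `uv_of_uvAtRecord12C_two` — at `N = 2`: the spine's leaf `Theses.BalabanLadder.UV` (`uvD59_two_iff`);
* `uvApexSUN_of_uvAtParams12`, `uvApexSUN_of_uvAtRecord12C` — `∀ N ≥ 3` packages ⇒ the R85 binder body `∀ N ≥ 3, UVD59 N` (`UVApexSUN`);
* `uvSUN_of_uvAtParams12`, `uvSUN_of_uvAtRecord12C` — `∀ N ≥ 2` packages ⇒ `UVSUN`.

So if the E1 definer re-types `UV` (and the owner `UVApexSUN`) over the pinned-record package, the landed closers `yangMills_of_recordSplit(_rotIR)`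
(binder 3 = `∀ N ≥ 3, UVD59 N`) are fed by one of these adapters; if not, nothing here is needed.  HONEST FRAMING: bookkeeping of a CONDITIONAL chain
(0∕6 legs); the packages are Bałaban's programme per `SU(N)`, OPEN; not a gap, not Clay.
-/

set_option autoImplicit false

noncomputable section

open Summit.QuantumFields.YangMills.Cruxes.UV.Record12

namespace Summit.QuantumFields.YangMills.Theorems.UVOtherGroups

section Pkg

variable {N : ℕ} [NeZero N]

/-- **θ-keyed pinned-record package ⇒ the `SU(N)` leaf `UVD59 N`** (p1's `stage0_of_uvAtParams12`, by name). -/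
theorem uvD59_of_uvAtParams12 (h : UVAtParams12 N) : YMDAG.UVSplit.UVD59 N :=
  fun F => stage0_of_uvAtParams12 h F

/-- **(D, w)-keyed pinned-record package ⇒ the `SU(N)` leaf `UVD59 N`** (p1's `stage0_of_uvAtRecord12C`, by name). -/
theorem uvD59_of_uvAtRecord12C (h : UVAtRecord12C N) : YMDAG.UVSplit.UVD59 N :=
  fun F => stage0_of_uvAtRecord12C h F

end Pkg

/-- At `N = 2`: the θ-keyed package ⇒ the spine's leaf `Theses.BalabanLadder.UV` BY NAME. -/
theorem uv_of_uvAtParams12_two (h : UVAtParams12 2) : Summit.QuantumFields.YangMills.Theses.BalabanLadder.UV :=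
  YMDAG.UVSplit.uvD59_two_iff.1 (uvD59_of_uvAtParams12 h)

/-- At `N = 2`: the (D, w)-keyed package ⇒ the spine's leaf `Theses.BalabanLadder.UV` BY NAME. -/
theorem uv_of_uvAtRecord12C_two (h : UVAtRecord12C 2) : Summit.QuantumFields.YangMills.Theses.BalabanLadder.UV :=
  YMDAG.UVSplit.uvD59_two_iff.1 (uvD59_of_uvAtRecord12C h)

/-- **θ-keyed packages for all `N ≥ 3` ⇒ the R85 binder body `UVApexSUN`** (`∀ N ≥ 3, YMDAG.UVSplit.UVD59 N`). -/
theorem uvApexSUN_of_uvAtParams12 (h : ∀ (N : ℕ) [NeZero N], 3 ≤ N → UVAtParams12 N) :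
    ∀ (N : ℕ) [NeZero N], 3 ≤ N → YMDAG.UVSplit.UVD59 N :=
  fun N _ hN => uvD59_of_uvAtParams12 (h N hN)

/-- (D, w)-keyed packages for all `N ≥ 3` ⇒ `∀ N ≥ 3, YMDAG.UVSplit.UVD59 N`. -/
theorem uvApexSUN_of_uvAtRecord12C (h : ∀ (N : ℕ) [NeZero N], 3 ≤ N → UVAtRecord12C N) :
    ∀ (N : ℕ) [NeZero N], 3 ≤ N → YMDAG.UVSplit.UVD59 N :=
  fun N _ hN => uvD59_of_uvAtRecord12C (h N hN)

/-- θ-keyed packages for all `N ≥ 2` ⇒ `UVSUN`. -/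
theorem uvSUN_of_uvAtParams12 (h : ∀ (N : ℕ) [NeZero N], 2 ≤ N → UVAtParams12 N) : UVSUN :=
  fun N _ hN => uvD59_of_uvAtParams12 (h N hN)

/-- (D, w)-keyed packages for all `N ≥ 2` ⇒ `UVSUN`. -/
theorem uvSUN_of_uvAtRecord12C (h : ∀ (N : ℕ) [NeZero N], 2 ≤ N → UVAtRecord12C N) : UVSUN :=
  fun N _ hN => uvD59_of_uvAtRecord12C (h N hN)

end Summit.QuantumFields.YangMills.Theorems.UVOtherGroups

end
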